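import Mathlib
import Summits.NavierStokesRegularity.NavierStokesRegularity.Theorems.FilamentSkeletonRssKelvinGateScaleA
import Summits.NavierStokesRegularity.NavierStokesRegularity.Theorems.FilamentSkeletonRssKelvinGateWeightKHeatHolder

/-!
# Route `FilamentSkeletonRss` · crux `TransverseReduction1A` (stmt-27414; successor of the aside `TransverseReductionRJ`,
# stmt-21221) — line `kelvin_gate`: free OU SLICES of WEIGHT-`a` HÖLDER DATA — dominations and weighted bounds

Helper file (theorems only, `--as helper`).  HONEST FRAMING: analysis bookkeeping for a HYPOTHETICAL filament-type rotating
self-similar blow-up route; nothing here bears on Navier–Stokes regularity; no stub is proved here.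

Data: a continuous field `G : ℝ³ → ℝ³` with `(1+|z|)^a ‖G z‖ ≤ A₀` (`1 < a < 2`) for which the weight-`a` heat toolkit
(`…KelvinGateWeightKHeatHolder.weightK_heat_toolkit`) holds with a constant `C_T` — value `≤ C_T A₀`, gradient `≤ C_T t^{-1/2} A₀`,
Hessian `≤ C_T (t^{-1+β/2} A₁ + t^{-1/2} A₀)` at heat times `t ≤ 1` (the three bounds are taken as HYPOTHESES `hV`, `hGr`, `hHe`, so
that this file is toolkit-agnostic).  For the free semigroup slice
`W_s(y) = (e^{-s/2} R_{−αs}) (e^{(1 − e^{-s})Δ} G)(e^{-s/2} R_{αs} y)` (written out; no definitions) we prove, for `s > 0`: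

* `norm_freeSlice_le_rpow_kernel` — `‖W_s(y)‖ ≤ C_T A₀ · e^{-s/2} (1 + e^{-s/2}|y|)^{-a}` (the transport kernel at exponent `a`);
* `norm_fderiv_freeSlice_le_uniform` — `‖DW_s(y)‖ ≤ C_T A₀ e^{-s} (1 + s^{-1/2})`;
  `rpow_weight_norm_fderiv_freeSlice_le` — `(1+|y|)^a ‖DW_s(y)‖ ≤ C_T A₀ e^{-(2−a)s/2} (1 + s^{-1/2})`;
* `norm_fderiv_fderiv_freeSlice_le_uniform` — `‖D²W_s(y)‖ ≤ C_T e^{-3s/2} ((1 + s^{-(1−β/2)}) A₁ + (1 + s^{-1/2}) A₀)`;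
  `rpow_weight_norm_fderiv_fderiv_freeSlice_le` — `(1+|y|)^a ‖D²W_s(y)‖ ≤ C_T e^{-(3−a)s/2} (same bracket)`.

(The derivative falls on the KERNEL, never on the datum: `G` is only continuous.  Target weight `a` on `DW`, `D²W` is traded for the
data weight by `(1+|y|)^a ≤ e^{as/2}(1+|x|)^a`, `x = e^{-s/2}R_{αs}y`, against the slice factors `e^{-s}`, `e^{-3s/2}` — hence `a < 2`.)
The resolvent `W = ∫₀^∞ W_s ds` is assembled in the next file.
-/

set_option linter.dupNamespace false

noncomputable section

namespace Summit.NavierStokesRegularity.NavierStokesRegularity.Theorems.KelvinGate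

open Set Function Filter Topology InnerProductSpace MeasureTheory Real Metric
open Literature.Analysis.FluidPDE Literature.Analysis.UnboundedOperators
open scoped Laplacian RealInnerProductSpace ContDiff Topology ENNReal

section Slices

variable {G : EuclideanSpace ℝ (Fin 3) → EuclideanSpace ℝ (Fin 3)} {a β A₀ A₁ C_T : ℝ}

/-- From the weight-`a` bound: `‖G z‖ ≤ A₀` and `0 ≤ A₀`. -/
theorem norm_le_and_nonneg_of_rpow_weight (ha : 0 ≤ a) (h0 : ∀ z, (1 + ‖z‖) ^ a * ‖G z‖ ≤ A₀) :
    (∀ z, ‖G z‖ ≤ A₀) ∧ 0 ≤ A₀ :=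
  ⟨norm_le_of_weight_rpow_mul_norm_le ha h0, le_trans (by positivity) (h0 0)⟩

/-- The norm of the conjugation point: `|e^{-s/2} R_{αs} y| = e^{-s/2} |y|`. -/
theorem norm_dilRot_apply (α s : ℝ) (y : EuclideanSpace ℝ (Fin 3)) :
    ‖(Real.exp (-(s / 2)) • rotZL (α * s)) y‖ = exp (-(s / 2)) * ‖y‖ := by
  rw [norm_smul_rotZL_apply, abs_of_pos (exp_pos _)]

/-! ## The value: transport kernel at exponent `a` -/

/-- **`‖W_s(y)‖ ≤ C_T A₀ · e^{-s/2}(1 + e^{-s/2}|y|)^{-a}`** from the weighted value bound `hV` of the caloric extension. -/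
theorem norm_freeSlice_le_rpow_kernel
    (hV : ∀ ⦃t : ℝ⦄, 0 < t → t ≤ 1 → ∀ x, (1 + ‖x‖) ^ a * ‖heatExtension G t x‖ ≤ C_T * A₀)
    (α : ℝ) {s : ℝ} (hs : 0 < s) (y : EuclideanSpace ℝ (Fin 3)) :
    ‖(Real.exp (-(s / 2)) • rotZL (-(α * s)))
        (heatExtension G (1 - Real.exp (-s)) ((Real.exp (-(s / 2)) • rotZL (α * s)) y))‖ ≤
      C_T * A₀ * (exp (-(s / 2)) * (1 + exp (-(s / 2)) * ‖y‖) ^ (-a)) := by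
  obtain ⟨hτ, hτ1⟩ := heatTime_mem_Ioc hs
  set x := (Real.exp (-(s / 2)) • rotZL (α * s)) y with hx
  have hxn : ‖x‖ = exp (-(s / 2)) * ‖y‖ := norm_dilRot_apply α s y
  have hw : 0 < (1 + ‖x‖) ^ a := by positivity
  have h1 : ‖heatExtension G (1 - exp (-s)) x‖ ≤ C_T * A₀ * (1 + ‖x‖) ^ (-a) := by
    rw [rpow_neg (by positivity), ← div_eq_mul_inv, le_div_iff₀ hw, mul_comm]
    exact hV hτ hτ1 x
  rw [norm_smul_rotZL_apply, abs_of_pos (exp_pos _)]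
  calc exp (-(s / 2)) * ‖heatExtension G (1 - exp (-s)) x‖
      ≤ exp (-(s / 2)) * (C_T * A₀ * (1 + ‖x‖) ^ (-a)) := mul_le_mul_of_nonneg_left h1 (exp_pos _).le
    _ = C_T * A₀ * (exp (-(s / 2)) * (1 + exp (-(s / 2)) * ‖y‖) ^ (-a)) := by rw [hxn]; ring

/-! ## The first derivative: one derivative on the kernel -/

/-- **Uniform domination of `DW_s`**: `‖DW_s(y)‖ ≤ C_T A₀ · e^{-s}(1 + s^{-1/2})`. -/
theorem norm_fderiv_freeSlice_le_uniform (ha : 0 ≤ a) (hG : Continuous G) (h0 : ∀ z, (1 + ‖z‖) ^ a * ‖G z‖ ≤ A₀)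
    (hGr : ∀ ⦃t : ℝ⦄, 0 < t → t ≤ 1 → ∀ x, (1 + ‖x‖) ^ a * ‖fderiv ℝ (heatExtension G t) x‖ ≤ C_T * t ^ (-(1 / 2 : ℝ)) * A₀)
    (α : ℝ) {s : ℝ} (hs : 0 < s) (y : EuclideanSpace ℝ (Fin 3)) :
    ‖fderiv ℝ (fun z => (Real.exp (-(s / 2)) • rotZL (-(α * s)))
        (heatExtension G (1 - Real.exp (-s)) ((Real.exp (-(s / 2)) • rotZL (α * s)) z))) y‖ ≤
      C_T * A₀ * (exp (-s) * (1 + s ^ (-(1 / 2 : ℝ)))) := by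
  obtain ⟨hC, hA₀⟩ := norm_le_and_nonneg_of_rpow_weight ha h0
  obtain ⟨hτ, hτ1⟩ := heatTime_mem_Ioc hs
  set x := (Real.exp (-(s / 2)) • rotZL (α * s)) y with hx
  have hCT : 0 ≤ C_T * A₀ := by
    have h := hGr hτ hτ1 x
    have h' : 0 ≤ C_T * (1 - exp (-s)) ^ (-(1 / 2 : ℝ)) * A₀ := le_trans (by positivity) h
    have hp : 0 < (1 - exp (-s)) ^ (-(1 / 2 : ℝ)) := rpow_pos_of_pos hτ _
    have he : C_T * A₀ = C_T * (1 - exp (-s)) ^ (-(1 / 2 : ℝ)) * A₀ / (1 - exp (-s)) ^ (-(1 / 2 : ℝ)) := by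
      field_simp
    rw [he]; exact div_nonneg h' hp.le
  -- the weighted gradient bound gives the unweighted one (`(1+|x|)^a ≥ 1`)
  have h1 : ‖fderiv ℝ (heatExtension G (1 - exp (-s))) x‖ ≤ C_T * (1 - exp (-s)) ^ (-(1 / 2 : ℝ)) * A₀ := by
    have hw1 : 1 ≤ (1 + ‖x‖) ^ a := one_le_rpow (by linarith [norm_nonneg x]) ha
    have h := hGr hτ hτ1 x
    nlinarith [norm_nonneg (fderiv ℝ (heatExtension G (1 - exp (-s))) x)]
  have h2 := heatTime_rpow_neg_le_one_add hs (by norm_num : (0:ℝ) ≤ 1 / 2) (by norm_num)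
  refine (norm_fderiv_freeSlice_le hG hC α hs y).trans ?_
  calc exp (-s) * ‖fderiv ℝ (heatExtension G (1 - exp (-s))) x‖
      ≤ exp (-s) * (C_T * (1 - exp (-s)) ^ (-(1 / 2 : ℝ)) * A₀) := mul_le_mul_of_nonneg_left h1 (exp_pos _).le
    _ = (C_T * A₀) * exp (-s) * (1 - exp (-s)) ^ (-(1 / 2 : ℝ)) := by ring
    _ ≤ (C_T * A₀) * exp (-s) * (1 + s ^ (-(1 / 2 : ℝ))) := mul_le_mul_of_nonneg_left h2 (by positivity)
    _ = C_T * A₀ * (exp (-s) * (1 + s ^ (-(1 / 2 : ℝ)))) := by ring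

/-- **Weighted bound of `DW_s`**: `(1+|y|)^a ‖DW_s(y)‖ ≤ C_T A₀ · e^{-(2−a)s/2}(1 + s^{-1/2})` (weight traded at cost `e^{as/2}`). -/
theorem rpow_weight_norm_fderiv_freeSlice_le (ha : 0 ≤ a) (hG : Continuous G) (h0 : ∀ z, (1 + ‖z‖) ^ a * ‖G z‖ ≤ A₀)
    (hGr : ∀ ⦃t : ℝ⦄, 0 < t → t ≤ 1 → ∀ x, (1 + ‖x‖) ^ a * ‖fderiv ℝ (heatExtension G t) x‖ ≤ C_T * t ^ (-(1 / 2 : ℝ)) * A₀)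
    (α : ℝ) {s : ℝ} (hs : 0 < s) (y : EuclideanSpace ℝ (Fin 3)) :
    (1 + ‖y‖) ^ a * ‖fderiv ℝ (fun z => (Real.exp (-(s / 2)) • rotZL (-(α * s)))
        (heatExtension G (1 - Real.exp (-s)) ((Real.exp (-(s / 2)) • rotZL (α * s)) z))) y‖ ≤
      C_T * A₀ * (exp (-((2 - a) / 2 * s)) * (1 + s ^ (-(1 / 2 : ℝ)))) := by
  obtain ⟨hC, hA₀⟩ := norm_le_and_nonneg_of_rpow_weight ha h0
  obtain ⟨hτ, hτ1⟩ := heatTime_mem_Ioc hs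
  set x := (Real.exp (-(s / 2)) • rotZL (α * s)) y with hx
  have hxn : ‖x‖ = exp (-(s / 2)) * ‖y‖ := norm_dilRot_apply α s y
  have h1 := hGr hτ hτ1 x
  have hCT : 0 ≤ C_T * A₀ := by
    have h' : 0 ≤ C_T * (1 - exp (-s)) ^ (-(1 / 2 : ℝ)) * A₀ := le_trans (by positivity) h1
    have hp : 0 < (1 - exp (-s)) ^ (-(1 / 2 : ℝ)) := rpow_pos_of_pos hτ _
    have he : C_T * A₀ = C_T * (1 - exp (-s)) ^ (-(1 / 2 : ℝ)) * A₀ / (1 - exp (-s)) ^ (-(1 / 2 : ℝ)) := by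
      field_simp
    rw [he]; exact div_nonneg h' hp.le
  have h2 := heatTime_rpow_neg_le_one_add hs (by norm_num : (0:ℝ) ≤ 1 / 2) (by norm_num)
  have hwt : (1 + ‖y‖) ^ a ≤ exp (a * s / 2) * (1 + ‖x‖) ^ a := by
    rw [hxn]; exact rpow_weight_le_exp_mul ha hs.le (norm_nonneg y)
  have hder := norm_fderiv_freeSlice_le hG hC α hs y
  calc (1 + ‖y‖) ^ a * ‖fderiv ℝ (fun z => (Real.exp (-(s / 2)) • rotZL (-(α * s)))
          (heatExtension G (1 - Real.exp (-s)) ((Real.exp (-(s / 2)) • rotZL (α * s)) z))) y‖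
      ≤ (exp (a * s / 2) * (1 + ‖x‖) ^ a) * (exp (-s) * ‖fderiv ℝ (heatExtension G (1 - exp (-s))) x‖) :=
        mul_le_mul hwt hder (norm_nonneg _) (by positivity)
    _ = exp (a * s / 2) * exp (-s) * ((1 + ‖x‖) ^ a * ‖fderiv ℝ (heatExtension G (1 - exp (-s))) x‖) := by ring
    _ ≤ exp (a * s / 2) * exp (-s) * (C_T * (1 - exp (-s)) ^ (-(1 / 2 : ℝ)) * A₀) :=
        mul_le_mul_of_nonneg_left h1 (by positivity)
    _ = (C_T * A₀) * (exp (a * s / 2) * exp (-s)) * (1 - exp (-s)) ^ (-(1 / 2 : ℝ)) := by ring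
    _ ≤ (C_T * A₀) * (exp (a * s / 2) * exp (-s)) * (1 + s ^ (-(1 / 2 : ℝ))) :=
        mul_le_mul_of_nonneg_left h2 (by positivity)
    _ = C_T * A₀ * (exp (-((2 - a) / 2 * s)) * (1 + s ^ (-(1 / 2 : ℝ)))) := by
        rw [← exp_add, show a * s / 2 + -s = -((2 - a) / 2 * s) by ring]; ring

/-! ## The second derivative: two derivatives on the kernel, Hölder gain -/

/-- The heat-time factor of the Hessian bound: for `s > 0`, `0 < β ≤ 1`,
`τ_s^{-1+β/2} A₁ + τ_s^{-1/2} A₀ ≤ (1 + s^{-(1−β/2)}) A₁ + (1 + s^{-1/2}) A₀` (`τ_s = 1 − e^{-s}`). -/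
theorem heatTime_hessian_factor_le {s : ℝ} (hs : 0 < s) (hβ0 : 0 < β) (hβ1 : β ≤ 1) (hA₀ : 0 ≤ A₀) (hA₁ : 0 ≤ A₁) :
    (1 - exp (-s)) ^ (-(1:ℝ) + β / 2) * A₁ + (1 - exp (-s)) ^ (-(1 / 2 : ℝ)) * A₀ ≤
      (1 + s ^ (-(1 - β / 2))) * A₁ + (1 + s ^ (-(1 / 2 : ℝ))) * A₀ := by
  have h1 : (1 - exp (-s)) ^ (-(1:ℝ) + β / 2) ≤ 1 + s ^ (-(1 - β / 2)) := by
    rw [show (-(1:ℝ) + β / 2) = -(1 - β / 2) by ring]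
    exact heatTime_rpow_neg_le_one_add hs (by linarith) (by linarith)
  have h2 := heatTime_rpow_neg_le_one_add hs (by norm_num : (0:ℝ) ≤ 1 / 2) (by norm_num)
  exact add_le_add (mul_le_mul_of_nonneg_right h1 hA₁) (mul_le_mul_of_nonneg_right h2 hA₀)

/-- **Uniform domination of `D²W_s`**: `‖D²W_s(y)‖ ≤ C_T e^{-3s/2} ((1 + s^{-(1−β/2)}) A₁ + (1 + s^{-1/2}) A₀)`. -/
theorem norm_fderiv_fderiv_freeSlice_le_uniform (ha : 0 ≤ a) (hβ0 : 0 < β) (hβ1 : β ≤ 1) (hA₁ : 0 ≤ A₁) (hCT : 0 ≤ C_T)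
    (hG : Continuous G) (h0 : ∀ z, (1 + ‖z‖) ^ a * ‖G z‖ ≤ A₀)
    (hHe : ∀ ⦃t : ℝ⦄, 0 < t → t ≤ 1 → ∀ x, (1 + ‖x‖) ^ a * ‖fderiv ℝ (fderiv ℝ (heatExtension G t)) x‖ ≤
      C_T * (t ^ (-(1:ℝ) + β / 2) * A₁ + t ^ (-(1 / 2 : ℝ)) * A₀))
    (α : ℝ) {s : ℝ} (hs : 0 < s) (y : EuclideanSpace ℝ (Fin 3)) :
    ‖fderiv ℝ (fun z => fderiv ℝ (fun z => (Real.exp (-(s / 2)) • rotZL (-(α * s)))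
        (heatExtension G (1 - Real.exp (-s)) ((Real.exp (-(s / 2)) • rotZL (α * s)) z))) z) y‖ ≤
      C_T * (exp (-(3 / 2 * s)) * ((1 + s ^ (-(1 - β / 2))) * A₁ + (1 + s ^ (-(1 / 2 : ℝ))) * A₀)) := by
  obtain ⟨hC, hA₀⟩ := norm_le_and_nonneg_of_rpow_weight ha h0
  obtain ⟨hτ, hτ1⟩ := heatTime_mem_Ioc hs
  set x := (Real.exp (-(s / 2)) • rotZL (α * s)) y with hx
  have h1 : ‖fderiv ℝ (fderiv ℝ (heatExtension G (1 - exp (-s)))) x‖ ≤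
      C_T * ((1 - exp (-s)) ^ (-(1:ℝ) + β / 2) * A₁ + (1 - exp (-s)) ^ (-(1 / 2 : ℝ)) * A₀) := by
    have hw1 : 1 ≤ (1 + ‖x‖) ^ a := one_le_rpow (by linarith [norm_nonneg x]) ha
    have h := hHe hτ hτ1 x
    have hrhs : 0 ≤ C_T * ((1 - exp (-s)) ^ (-(1:ℝ) + β / 2) * A₁ + (1 - exp (-s)) ^ (-(1 / 2 : ℝ)) * A₀) := by
      positivity
    nlinarith [norm_nonneg (fderiv ℝ (fderiv ℝ (heatExtension G (1 - exp (-s)))) x)]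
  have h2 := heatTime_hessian_factor_le (A₀ := A₀) (A₁ := A₁) hs hβ0 hβ1 hA₀ hA₁
  have hexp : exp (-(s / 2)) * exp (-s) = exp (-(3 / 2 * s)) := by rw [← exp_add]; congr 1; ring
  refine (norm_fderiv_fderiv_freeSlice_le hG hC α hs y).trans ?_
  rw [hexp]
  calc exp (-(3 / 2 * s)) * ‖fderiv ℝ (fderiv ℝ (heatExtension G (1 - exp (-s)))) x‖
      ≤ exp (-(3 / 2 * s)) * (C_T * ((1 - exp (-s)) ^ (-(1:ℝ) + β / 2) * A₁ + (1 - exp (-s)) ^ (-(1 / 2 : ℝ)) * A₀)) :=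
        mul_le_mul_of_nonneg_left h1 (exp_pos _).le
    _ ≤ exp (-(3 / 2 * s)) * (C_T * ((1 + s ^ (-(1 - β / 2))) * A₁ + (1 + s ^ (-(1 / 2 : ℝ))) * A₀)) :=
        mul_le_mul_of_nonneg_left (mul_le_mul_of_nonneg_left h2 hCT) (exp_pos _).le
    _ = _ := by ring

/-- **Weighted bound of `D²W_s`**: `(1+|y|)^a ‖D²W_s(y)‖ ≤ C_T e^{-(3−a)s/2} ((1 + s^{-(1−β/2)}) A₁ + (1 + s^{-1/2}) A₀)`. -/
theorem rpow_weight_norm_fderiv_fderiv_freeSlice_le (ha : 0 ≤ a) (hβ0 : 0 < β) (hβ1 : β ≤ 1) (hA₁ : 0 ≤ A₁)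
    (hCT : 0 ≤ C_T) (hG : Continuous G) (h0 : ∀ z, (1 + ‖z‖) ^ a * ‖G z‖ ≤ A₀)
    (hHe : ∀ ⦃t : ℝ⦄, 0 < t → t ≤ 1 → ∀ x, (1 + ‖x‖) ^ a * ‖fderiv ℝ (fderiv ℝ (heatExtension G t)) x‖ ≤
      C_T * (t ^ (-(1:ℝ) + β / 2) * A₁ + t ^ (-(1 / 2 : ℝ)) * A₀))
    (α : ℝ) {s : ℝ} (hs : 0 < s) (y : EuclideanSpace ℝ (Fin 3)) :
    (1 + ‖y‖) ^ a * ‖fderiv ℝ (fun z => fderiv ℝ (fun z => (Real.exp (-(s / 2)) • rotZL (-(α * s)))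
        (heatExtension G (1 - Real.exp (-s)) ((Real.exp (-(s / 2)) • rotZL (α * s)) z))) z) y‖ ≤
      C_T * (exp (-((3 - a) / 2 * s)) * ((1 + s ^ (-(1 - β / 2))) * A₁ + (1 + s ^ (-(1 / 2 : ℝ))) * A₀)) := by
  obtain ⟨hC, hA₀⟩ := norm_le_and_nonneg_of_rpow_weight ha h0
  obtain ⟨hτ, hτ1⟩ := heatTime_mem_Ioc hs
  set x := (Real.exp (-(s / 2)) • rotZL (α * s)) y with hx
  have hxn : ‖x‖ = exp (-(s / 2)) * ‖y‖ := norm_dilRot_apply α s y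
  have h1 := hHe hτ hτ1 x
  have h2 := heatTime_hessian_factor_le (A₀ := A₀) (A₁ := A₁) hs hβ0 hβ1 hA₀ hA₁
  have hwt : (1 + ‖y‖) ^ a ≤ exp (a * s / 2) * (1 + ‖x‖) ^ a := by
    rw [hxn]; exact rpow_weight_le_exp_mul ha hs.le (norm_nonneg y)
  have hder := norm_fderiv_fderiv_freeSlice_le hG hC α hs y
  have hB : 0 ≤ (1 + s ^ (-(1 - β / 2))) * A₁ + (1 + s ^ (-(1 / 2 : ℝ))) * A₀ := by positivity
  calc (1 + ‖y‖) ^ a * ‖fderiv ℝ (fun z => fderiv ℝ (fun z => (Real.exp (-(s / 2)) • rotZL (-(α * s)))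
          (heatExtension G (1 - Real.exp (-s)) ((Real.exp (-(s / 2)) • rotZL (α * s)) z))) z) y‖
      ≤ (exp (a * s / 2) * (1 + ‖x‖) ^ a) *
          (exp (-(s / 2)) * exp (-s) * ‖fderiv ℝ (fderiv ℝ (heatExtension G (1 - exp (-s)))) x‖) :=
        mul_le_mul hwt hder (by positivity) (by positivity)
    _ = exp (a * s / 2) * exp (-(s / 2)) * exp (-s) *
          ((1 + ‖x‖) ^ a * ‖fderiv ℝ (fderiv ℝ (heatExtension G (1 - exp (-s)))) x‖) := by ring
    _ ≤ exp (a * s / 2) * exp (-(s / 2)) * exp (-s) *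
          (C_T * ((1 - exp (-s)) ^ (-(1:ℝ) + β / 2) * A₁ + (1 - exp (-s)) ^ (-(1 / 2 : ℝ)) * A₀)) :=
        mul_le_mul_of_nonneg_left h1 (by positivity)
    _ ≤ exp (a * s / 2) * exp (-(s / 2)) * exp (-s) *
          (C_T * ((1 + s ^ (-(1 - β / 2))) * A₁ + (1 + s ^ (-(1 / 2 : ℝ))) * A₀)) :=
        mul_le_mul_of_nonneg_left (mul_le_mul_of_nonneg_left h2 hCT) (by positivity)
    _ = C_T * ((exp (a * s / 2) * exp (-(s / 2)) * exp (-s)) *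
          ((1 + s ^ (-(1 - β / 2))) * A₁ + (1 + s ^ (-(1 / 2 : ℝ))) * A₀)) := by ring
    _ = C_T * (exp (-((3 - a) / 2 * s)) * ((1 + s ^ (-(1 - β / 2))) * A₁ + (1 + s ^ (-(1 / 2 : ℝ))) * A₀)) := by
        rw [← exp_add, ← exp_add, show a * s / 2 + -(s / 2) + -s = -((3 - a) / 2 * s) by ring]

end Slices

end Summit.NavierStokesRegularity.NavierStokesRegularity.Theorems.KelvinGate

end
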